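import Mathlib.Algebra.Order.Floor.Defs
import Mathlib.Algebra.Order.Floor.Semiring
import Mathlib.Algebra.BigOperators.Intervals
import Mathlib.Analysis.SpecificLimits.Basic
import Mathlib.Tactic
import HarnessLib

/-!
# The seeding blocks of CDT §6.4: `j ∈ [⌈γ_k d/m⌉, ⌈γ_{k+1} d/m⌉)`

Calegari–Dimitrov–Tang, arXiv:2408.15403, §6.4 (p. 51): the index set `{1,…,d}` is partitioned
into `l+1` consecutive blocks, block `k ∈ {0,…,l}` consisting of the `j` with
`γ_k/m ≤ j/d < γ_{k+1}/m`, i.e. `j ∈ {⌈γ_k d/m⌉, …, ⌈γ_{k+1} d/m⌉ − 1}`, for exponents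
`0 = γ_0 < γ_1 < ⋯ < γ_l < γ_{l+1} = m`; `d^{(k)} = ⌈γ_{k+1}d/m⌉ − ⌈γ_k d/m⌉` is the block length
(§6.5.4). This file records the bookkeeping used in §§6.4–6.5: the block boundaries
`blockStart`, the lengths `blockLen`, `Σ_k d^{(k)} = d`, the lower bound `d^{(k)} ≥ λ d`
(`λ = min_k (γ_{k+1} − γ_k)/(2m)`) for large `d` (the hypothesis of the uniform dampener bound
`Discrepancy.dampener_le_exp_neg`), and the rank-window sums
`Σ_{j ∈ block k} (j+1) = (b(b+1) − a(a+1))/2` and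
`|2Σ_{j∈block k} (j+1) − ((γ_{k+1}d/m)² − (γ_k d/m)²)| ≤ 3(γ_{k+1}d/m + 1)`
(`abs_two_mul_sum_block_sub_le`, the source of eq. (6.17) via
`Discrepancy.abs_sum_orderStat_sub_le`).

No named facts.

## References

* [CalegariDimitrovTang2024] arXiv:2408.15403, §6.4 (p. 51), §6.5.4 (p. 53).
-/

noncomputable section

open Finset

namespace Literature.NumberTheory.Transcendental

namespace CalegariDimitrovTang

variable {l : ℕ}

/-- The block boundaries `⌈γ_k d/m⌉` (`k = 0,…,l+1`). [cite: CalegariDimitrovTang2024, §6.4] -/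
def blockStart (γ : Fin (l + 2) → ℝ) (m d : ℕ) (k : Fin (l + 2)) : ℕ := ⌈γ k * d / m⌉₊

/-- The block lengths `d^{(k)} = ⌈γ_{k+1} d/m⌉ − ⌈γ_k d/m⌉` (`k = 0,…,l`).
[cite: CalegariDimitrovTang2024, §6.5.4 (p. 53)] -/
def blockLen (γ : Fin (l + 2) → ℝ) (m d : ℕ) (k : Fin (l + 1)) : ℕ :=
  blockStart γ m d k.succ - blockStart γ m d k.castSucc

/-- The standing hypotheses on the exponents: `0 = γ_0 < γ_1 < ⋯ < γ_{l+1} = m`.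
[cite: CalegariDimitrovTang2024, §6.4 / Theorem 52] -/
structure SeedData (γ : Fin (l + 2) → ℝ) (m : ℕ) : Prop where
  zero : γ 0 = 0
  last : γ (Fin.last (l + 1)) = m
  strictMono : StrictMono γ

namespace SeedData

variable {γ : Fin (l + 2) → ℝ} {m : ℕ}

/-- `γ_k ≥ 0`. [folklore] -/
theorem nonneg (h : SeedData γ m) (k : Fin (l + 2)) : 0 ≤ γ k := by
  rw [← h.zero]; exact h.strictMono.monotone (Fin.zero_le k)

/-- `γ_k ≤ m`. [folklore] -/
theorem le_m (h : SeedData γ m) (k : Fin (l + 2)) : γ k ≤ m := by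
  rw [← h.last]; exact h.strictMono.monotone (Fin.le_last k)

/-- `m ≥ 1`. [folklore] -/
theorem m_pos (h : SeedData γ m) : 0 < m := by
  have := h.strictMono (show (0 : Fin (l + 2)) < Fin.last (l + 1) from Fin.last_pos)
  rw [h.zero, h.last] at this
  exact_mod_cast this

/-- The boundaries are monotone in `k`. [folklore] -/
theorem blockStart_mono (h : SeedData γ m) (d : ℕ) : Monotone (blockStart γ m d) := by
  intro a b hab
  unfold blockStart
  apply Nat.ceil_mono
  have hm : (0 : ℝ) < m := by exact_mod_cast h.m_pos
  apply div_le_div_of_nonneg_right _ hm.le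
  exact mul_le_mul_of_nonneg_right (h.strictMono.monotone hab) (Nat.cast_nonneg d)

/-- `⌈γ_0 d/m⌉ = 0`. [folklore] -/
theorem blockStart_zero (h : SeedData γ m) (d : ℕ) : blockStart γ m d 0 = 0 := by
  simp [blockStart, h.zero]

/-- `⌈γ_{l+1} d/m⌉ = d`. [folklore] -/
theorem blockStart_last (h : SeedData γ m) (d : ℕ) : blockStart γ m d (Fin.last (l + 1)) = d := by
  have hm : (m : ℝ) ≠ 0 := by exact_mod_cast h.m_pos.ne'
  simp [blockStart, h.last, mul_div_cancel_left₀ _ hm]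

/-- **The blocks partition `{0,…,d−1}`: `Σ_k d^{(k)} = d`.** [cite: CalegariDimitrovTang2024,
§6.5.4 ("`d = d_0 + ⋯ + d_l`")] -/
theorem sum_blockLen (h : SeedData γ m) (d : ℕ) : ∑ k, blockLen γ m d k = d := by
  have hmono := h.blockStart_mono d
  -- a total monotone sequence extending the boundaries
  let sq : ℕ → ℕ := fun n => blockStart γ m d ⟨min n (l + 1), by omega⟩
  have hsq : Monotone sq := by
    intro a b hab
    exact hmono (Fin.mk_le_mk.mpr (min_le_min_right (l + 1) hab))
  have hterm : ∀ i : Fin (l + 1), blockLen γ m d i = sq ((i : ℕ) + 1) - sq i := by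
    intro i
    have h1 : (⟨min ((i : ℕ) + 1) (l + 1), by omega⟩ : Fin (l + 2)) = i.succ :=
      Fin.ext (by simp [Nat.min_eq_left (show (i : ℕ) + 1 ≤ l + 1 by omega)])
    have h2 : (⟨min (i : ℕ) (l + 1), by omega⟩ : Fin (l + 2)) = i.castSucc :=
      Fin.ext (by simp)
    simp only [blockLen, sq, h1, h2]
  rw [Finset.sum_congr rfl fun i _ => hterm i, Fin.sum_univ_eq_sum_range (fun i => sq (i + 1) - sq i) (l + 1),
    Finset.sum_range_tsub hsq]
  have h0 : sq 0 = 0 := by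
    show blockStart γ m d ⟨min 0 (l + 1), _⟩ = 0
    have : (⟨min 0 (l + 1), by omega⟩ : Fin (l + 2)) = 0 := Fin.ext (by simp)
    rw [this, h.blockStart_zero]
  have hl : sq (l + 1) = d := by
    show blockStart γ m d ⟨min (l + 1) (l + 1), _⟩ = d
    have : (⟨min (l + 1) (l + 1), by omega⟩ : Fin (l + 2)) = Fin.last (l + 1) := Fin.ext (by simp)
    rw [this, h.blockStart_last]
  rw [h0, hl, Nat.sub_zero]

/-- The gap parameter `λ = min_k (γ_{k+1} − γ_k)/(2m) > 0`. [folklore] -/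
def lam (γ : Fin (l + 2) → ℝ) (m : ℕ) : ℝ :=
  (Finset.univ.inf' Finset.univ_nonempty fun k : Fin (l + 1) => γ k.succ - γ k.castSucc) / (2 * m)

/-- `λ > 0`. [folklore] -/
theorem lam_pos (h : SeedData γ m) : 0 < lam γ m := by
  unfold lam
  have hm : (0 : ℝ) < m := by exact_mod_cast h.m_pos
  apply div_pos _ (by positivity)
  rw [Finset.lt_inf'_iff]
  intro k _
  have := h.strictMono (Fin.castSucc_lt_succ (i := k))
  linarith

/-- `2mλ ≤ γ_{k+1} − γ_k`. [folklore] -/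
theorem lam_le (h : SeedData γ m) (k : Fin (l + 1)) :
    lam γ m * (2 * m) ≤ γ k.succ - γ k.castSucc := by
  unfold lam
  have hm : (0 : ℝ) < m := by exact_mod_cast h.m_pos
  rw [div_mul_cancel₀ _ (by positivity)]
  exact Finset.inf'_le _ (Finset.mem_univ k)

/-- **The blocks have length `≥ λd` once `d ≥ 1/λ`**: `d^{(k)} ≥ (γ_{k+1} − γ_k) d/m − 1 ≥ 2λd − 1 ≥ λd`.
[cite: CalegariDimitrovTang2024, §6.5.3 (uniformity of (6.19) in `d`)] -/
theorem lam_mul_le_blockLen (h : SeedData γ m) {d : ℕ} (hd : 1 ≤ lam γ m * d) (k : Fin (l + 1)) :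
    lam γ m * d ≤ blockLen γ m d k := by
  have hm : (0 : ℝ) < m := by exact_mod_cast h.m_pos
  unfold blockLen blockStart
  have h1 : (⌈γ k.castSucc * d / m⌉₊ : ℝ) < γ k.castSucc * d / m + 1 :=
    Nat.ceil_lt_add_one (div_nonneg (mul_nonneg (h.nonneg _) (Nat.cast_nonneg _)) hm.le)
  have h2 : γ k.succ * d / m ≤ (⌈γ k.succ * d / m⌉₊ : ℝ) := Nat.le_ceil _
  have hgap := h.lam_le k
  have hle : ⌈γ k.castSucc * d / m⌉₊ ≤ ⌈γ k.succ * d / m⌉₊ := by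
    apply Nat.ceil_mono
    apply div_le_div_of_nonneg_right _ hm.le
    exact mul_le_mul_of_nonneg_right (h.strictMono.monotone (Fin.castSucc_lt_succ (i := k)).le) (Nat.cast_nonneg d)
  rw [Nat.cast_sub hle]
  have hdiff : (γ k.succ - γ k.castSucc) * d / m ≥ lam γ m * (2 * m) * d / m := by
    apply div_le_div_of_nonneg_right _ hm.le
    exact mul_le_mul_of_nonneg_right hgap (Nat.cast_nonneg d)
  have hsimp : lam γ m * (2 * m) * d / m = 2 * (lam γ m * d) := by field_simp
  rw [hsimp] at hdiff
  have : (γ k.succ - γ k.castSucc) * d / m = γ k.succ * d / m - γ k.castSucc * d / m := by ring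
  rw [this] at hdiff
  linarith

/-! ### Rank-window sums -/

/-- `Σ_{a ≤ j < b} (j+1) · 2 = b(b+1) − a(a+1)` (`a ≤ b`). [folklore] -/
theorem sum_Ico_succ_mul_two {a b : ℕ} (hab : a ≤ b) :
    (∑ j ∈ Finset.Ico a b, ((j : ℝ) + 1)) * 2 = (b : ℝ) * (b + 1) - a * (a + 1) := by
  induction b, hab using Nat.le_induction with
  | base => simp
  | succ n hn ih =>
    rw [Finset.sum_Ico_succ_top hn, add_mul, ih]
    push_cast; ring

/-- The block `k` as a set of ranks. [cite: CalegariDimitrovTang2024, §6.4] -/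
def block (γ : Fin (l + 2) → ℝ) (m d : ℕ) (k : Fin (l + 1)) : Finset ℕ :=
  Finset.Ico (blockStart γ m d k.castSucc) (blockStart γ m d k.succ)

/-- `#block k = d^{(k)}`. [folklore] -/
theorem card_block (γ : Fin (l + 2) → ℝ) (m d : ℕ) (k : Fin (l + 1)) :
    (block γ m d k).card = blockLen γ m d k := by
  simp [block, blockLen]

/-- **The rank-window sum of block `k` is `(γ_{k+1}² − γ_k²) d²/(2m²) + O(d)`**, in the
explicit form `|2 Σ_{j∈block k}(j+1) − ((γ_{k+1}d/m)² − (γ_k d/m)²)| ≤ 3 (γ_{k+1} d/m + 1)`.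
This is the arithmetic behind eq. (6.17) (combine with `Discrepancy.abs_sum_orderStat_sub_le`).
[cite: CalegariDimitrovTang2024, §6.4 eq. (6.17)] -/
theorem abs_two_mul_sum_block_sub_le (h : SeedData γ m) (d : ℕ) (k : Fin (l + 1)) :
    |(∑ j ∈ block γ m d k, ((j : ℝ) + 1)) * 2 -
        ((γ k.succ * d / m) ^ 2 - (γ k.castSucc * d / m) ^ 2)| ≤
      3 * (γ k.succ * d / m + 1) := by
  have hm : (0 : ℝ) < m := by exact_mod_cast h.m_pos
  set a := blockStart γ m d k.castSucc with ha
  set b := blockStart γ m d k.succ with hb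
  have hab : a ≤ b := h.blockStart_mono d (Fin.castSucc_lt_succ (i := k)).le
  rw [block, sum_Ico_succ_mul_two hab]
  -- `x ≤ a < x + 1`, `y ≤ b < y + 1` with `x = γ_k d/m`, `y = γ_{k+1} d/m`, `0 ≤ x ≤ y`
  set x := γ k.castSucc * d / m with hx
  set y := γ k.succ * d / m with hy
  have hx0 : 0 ≤ x := div_nonneg (mul_nonneg (h.nonneg _) (Nat.cast_nonneg _)) hm.le
  have hy0 : 0 ≤ y := div_nonneg (mul_nonneg (h.nonneg _) (Nat.cast_nonneg _)) hm.le
  have hxy : x ≤ y := div_le_div_of_nonneg_right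
    (mul_le_mul_of_nonneg_right (h.strictMono.monotone (Fin.castSucc_lt_succ (i := k)).le) (Nat.cast_nonneg d)) hm.le
  have ha1 : x ≤ a := Nat.le_ceil _
  have ha2 : (a : ℝ) < x + 1 := Nat.ceil_lt_add_one hx0
  have hb1 : y ≤ b := Nat.le_ceil _
  have hb2 : (b : ℝ) < y + 1 := Nat.ceil_lt_add_one hy0
  rw [abs_le]
  constructor <;> nlinarith

end SeedData

end CalegariDimitrovTang

end Literature.NumberTheory.Transcendental
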